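import Literature.Computability.AlgebraicComplexity.AlmanLi2026OneFunctionalSpeedup
import Literature.Computability.AlgebraicComplexity.AlmanLi2026Bootstrap
import Literature.Computability.AlgebraicComplexity.AlmanLi2026CWRankFunctional
import Literature.Computability.AlgebraicComplexity.AlmanLi2026TensorPowerDecomposition
import Literature.Computability.AlgebraicComplexity.BorderRankCWDischarge
import HarnessLib

/-!
# `cw_q^{⊗n} ⊕ ⟨1, (q+2)^n − 2(q+1)^n + q^n, 1⟩ ⊴ ⟨(q+2)^n⟩ ⊕ ⟨1, q^n, 1⟩` (Alman–Li 2026, Prop. 7.1)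

Topic `Literature/Computability/AlgebraicComplexity` (family `MatrixMultiplication`). Source: J. Alman,
B. Li, *Asymptotic Rank Speedup Theorems, Revisited*, arXiv:2605.21738 (2026), §7.1, Proposition 7.1
(held text `paper:arxiv-2605.21738`, p0017 L63–83), assembled from the tree's kernel versions of its
ingredients: the Coppersmith–Winograd identity (the explicit data of `BorderRankCWDischarge.lean`,
restated here as terms), Lemma 7.1 (`AlmanLi2026CWRankFunctional`), the tensoring facts
(`AlmanLi2026TensorPowerDecomposition`), Thm. 6.1 for rank decompositions over the FIELD `K(λ)`
(`AlmanLi2026OneFunctionalSpeedup`, `thm61_rankDecomposition_equiv`) and the bootstrapping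
`K(λ) → K` of Cor. 5.1 (`AlmanLi2026Bootstrap`, `algDegeneratesTo_of_isFractionRing`).

## The printed statement (p0017)

"**Proposition 7.1.** For any `q ≥ 2` and `n ≥ 1`, we have the tensor degeneration
`cw_q^{⊗n} ⊕ ⟨1, (q+2)^n − 2(q+1)^n + q^n, 1⟩ ⊴ ⟨(q+2)^n⟩ ⊕ ⟨1, q^n, 1⟩`."

## The form proved here

`AlmanLi2026.prop71`: over any field `K`, for all `q n : ℕ` (no restriction is needed; for `q < 2` or
`n = 0` the statement is degenerate but true),
`AlgDegeneratesTo (⟨(q+2)^n⟩ ⊕ rotate ⟨1,q^n,1⟩) (cw_q^{⊠n} ⊕ rotate ⟨1, (q+2)^n + q^n − 2(q+1)^n, 1⟩)`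
with the tree's `cwTensor K q`, `kroneckerPow`, `unitTensor`, `directSumTensor`, and the slice
`⟨1,t,1⟩` with trivial factor third written `rotate (oneSliceTensor K (Fin t))` (truncated subtraction).
Route (the printed proof, made explicit): over `L = RatFunc K` the CW data give a RANK-`(q+2)`
decomposition of `T_L = λ³ cw_q + O(λ⁴)` (entries in `K[λ] ⊆ L`); Lemma 7.1 gives nonzero `c'` with
`rank (∑ c'ᵢ aᵢ bᵢᵀ) ≤ q`; tensoring, `rank ≤ q^n`; Thm. 6.1 (rank-decomposition case) over `L`;
equalise the `λ`-order of the slice block (scale by `λ^{3n}`, an `L`-restriction); bootstrap to `K`.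
No new definitions, no named facts.

## References

* J. Alman, B. Li, *Asymptotic Rank Speedup Theorems, Revisited*, arXiv:2605.21738 (2026), Prop. 7.1
  (p0017). [AlmanLi2026]
* J. M. Landsberg, *Geometry and Complexity Theory* (2017), Prop. 3.4.9.1 (the CW degeneration;
  tree `exists_isApproxDecomposition_three_cwTensor`). [Landsberg2017]
-/

noncomputable section

open scoped BigOperators Matrix Polynomial
open Polynomial

namespace Literature.Computability.AlgebraicComplexity

universe u

namespace AlmanLi2026

variable (K : Type u) [Field K] (q : ℕ)

/-! ## The Coppersmith–Winograd data, as terms (the witnesses of `exists_isApproxDecomposition_three_cwTensor`) -/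

/-- The explicit CW triads over `K[ε]` form an order-`3` approximate decomposition of `T_{cw,q}`
(the tree's `exists_isApproxDecomposition_three_cwTensor`, with its witnesses written out so that
Lemma 7.1 can be applied to them). [cite: Landsberg2017, Prop. 3.4.9.1] -/
theorem isApproxDecomposition_three_cwTensor_terms :
    IsApproxDecomposition 3 (cwTensor K q)
      (Fin.append (fun i : Fin q => (Fin.cases X fun a => if a = i then X ^ 2 else 0 : Fin (q + 1) → K[X]))
        ![Fin.cases (-1) fun _ => -X ^ 2, Fin.cases (1 - (q : K[X]) * X) fun _ => 0])
      (Fin.append (fun i : Fin q => (Fin.cases 1 fun b => if b = i then X else 0 : Fin (q + 1) → K[X]))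
        ![Fin.cases 1 fun _ => X ^ 2, Fin.cases 1 fun _ => 0])
      (Fin.append (fun i : Fin q => (Fin.cases 1 fun b => if b = i then X else 0 : Fin (q + 1) → K[X]))
        ![Fin.cases 1 fun _ => X ^ 2, Fin.cases 1 fun _ => 0]) := by
  intro a b c j hj
  rw [Fin.sum_univ_add, Fin.sum_univ_two]
  simp only [Fin.append_left, Fin.append_right, Matrix.cons_val_zero, Matrix.cons_val_one]
  obtain rfl | ⟨a', rfl⟩ := a.eq_zero_or_eq_succ <;>
  obtain rfl | ⟨b', rfl⟩ := b.eq_zero_or_eq_succ <;>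
  obtain rfl | ⟨c', rfl⟩ := c.eq_zero_or_eq_succ
  · refine coeff_eq_of_eq_X_pow_three_mul_add K (Q := 0) ?_ hj
    simp [cwTensor_apply]
    ring
  · refine coeff_eq_of_eq_X_pow_three_mul_add K (Q := 0) ?_ hj
    simp [cwTensor_apply, mul_ite]
    ring
  · refine coeff_eq_of_eq_X_pow_three_mul_add K (Q := 0) ?_ hj
    simp [cwTensor_apply, mul_ite]
    ring
  · refine coeff_eq_of_eq_X_pow_three_mul_add K (Q := -1) ?_ hj
    by_cases hbc : b' = c'
    · subst hbc
      simp [cwTensor_apply, mul_ite, ite_mul]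
      ring
    · simp [cwTensor_apply, mul_ite, ite_mul, hbc]
      ring
  · refine coeff_eq_of_eq_X_pow_three_mul_add K (Q := 0) ?_ hj
    simp [cwTensor_apply]
  · refine coeff_eq_of_eq_X_pow_three_mul_add K (Q := -1) ?_ hj
    by_cases hac : a' = c'
    · subst hac
      simp [cwTensor_apply, mul_ite, ite_mul]
      ring
    · simp [cwTensor_apply, mul_ite, ite_mul, hac]
      ring
  · refine coeff_eq_of_eq_X_pow_three_mul_add K (Q := -1) ?_ hj
    by_cases hab : a' = b'
    · subst hab
      simp [cwTensor_apply, mul_ite, ite_mul]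
      ring
    · simp [cwTensor_apply, mul_ite, ite_mul, hab]
      ring
  · by_cases hab : a' = b'
    · subst hab
      by_cases hac : a' = c'
      · subst hac
        refine coeff_eq_of_eq_X_pow_three_mul_add K (Q := 1 - X ^ 2) ?_ hj
        simp [cwTensor_apply, mul_ite, ite_mul]
        ring
      · refine coeff_eq_of_eq_X_pow_three_mul_add K (Q := -X ^ 2) ?_ hj
        simp [cwTensor_apply, mul_ite, ite_mul, hac]
        ring
    · by_cases hbc : b' = c'
      · subst hbc
        refine coeff_eq_of_eq_X_pow_three_mul_add K (Q := -X ^ 2) ?_ hj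
        simp [cwTensor_apply, mul_ite, ite_mul, hab]
        ring
      · refine coeff_eq_of_eq_X_pow_three_mul_add K (Q := -X ^ 2) ?_ hj
        simp [cwTensor_apply, mul_ite, ite_mul, hbc]
        ring

/-! ## Prop. 7.1 -/

/-- Images of `0/1` tensors: `⟨r⟩ ⊕ ⟨1,s,1⟩` over `L` is the image of `⟨r⟩ ⊕ ⟨1,s,1⟩` over `K`.
[folklore] -/
private theorem directSum_unit_slice_eq_map {L : Type*} [CommRing L] [Algebra K[X] L] (r s : ℕ) :
    directSumTensor (unitTensor L r) (rotate (oneSliceTensor L (Fin s))) =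
      fun a b c => algebraMap K[X] L (Polynomial.C
        (directSumTensor (unitTensor K r) (rotate (oneSliceTensor K (Fin s))) a b c)) := by
  funext a b c
  rcases a with a | a <;> rcases b with b | b <;> rcases c with c | c <;>
    simp [directSumTensor, unitTensor_apply, rotate_apply, oneSliceTensor_apply, apply_ite Polynomial.C,
      apply_ite (algebraMap K[X] L)]

/-- **The border-rank data of `cw_q` with Lemma 7.1's functional, over `L = K(λ)`** (Alman–Li
2026, proof of Prop. 7.1, first half): a `K[λ]`-family `P₁ = λ³ cw_q + O(λ⁴)` whose image over
`L = RatFunc K` has a rank-`(q+2)` decomposition `∑ᵢ uᵢ ⊗ vᵢ ⊗ wᵢ` (the CW border-rank identity),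
together with NONZERO scalars `c'ᵢ ∈ L` such that `rank ∑ᵢ c'ᵢ uᵢvᵢᵀ ≤ q` (Lemma 7.1).
[cite: AlmanLi2026, Prop. 7.1 (proof) with Lemma 7.1] -/
theorem prop71_data :
    ∃ (P₁ : Fin (q + 1) → Fin (q + 1) → Fin (q + 1) → K[X])
      (u v w : Fin (q + 2) → Fin (q + 1) → RatFunc K) (c' : Fin (q + 2) → RatFunc K),
      (∀ a b c, ∀ j ≤ 3, (P₁ a b c).coeff j = if j = 3 then cwTensor K q a b c else 0) ∧
      (∀ a b c, algebraMap K[X] (RatFunc K) (P₁ a b c) = ∑ i, u i a * v i b * w i c) ∧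
      (∀ i, c' i ≠ 0) ∧
      (Matrix.of fun a b : Fin (q + 1) => ∑ i, u i a * v i b * c' i).rank ≤ q := by
  classical
  -- the field `L = K(λ) = RatFunc K` and the embedding `φ : K[λ] → L`
  set φ : K[X] →+* RatFunc K := algebraMap K[X] (RatFunc K) with hφdef
  have hφ : Function.Injective φ := IsFractionRing.injective K[X] (RatFunc K)
  -- the CW data `u` (first mode, carrying the scalars) and `v` (second = third mode)
  obtain ⟨u, hu⟩ : ∃ u : Fin (q + 2) → Fin (q + 1) → K[X], u =
      Fin.append (fun i : Fin q => (Fin.cases X fun a => if a = i then X ^ 2 else 0 : Fin (q + 1) → K[X]))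
        ![Fin.cases (-1) fun _ => -X ^ 2, Fin.cases (1 - (q : K[X]) * X) fun _ => 0] := ⟨_, rfl⟩
  obtain ⟨v, hv⟩ : ∃ v : Fin (q + 2) → Fin (q + 1) → K[X], v =
      Fin.append (fun i : Fin q => (Fin.cases 1 fun b => if b = i then X else 0 : Fin (q + 1) → K[X]))
        ![Fin.cases 1 fun _ => X ^ 2, Fin.cases 1 fun _ => 0] := ⟨_, rfl⟩
  have hdec : IsApproxDecomposition 3 (cwTensor K q) u v v := by
    rw [hu, hv]; exact isApproxDecomposition_three_cwTensor_terms K q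
  -- `P₁ = ∑ uᵢ ⊗ vᵢ ⊗ vᵢ = λ³ cw_q + O(λ⁴)` and `T_L = φ ∘ P₁` with its rank decomposition over `L`
  obtain ⟨P₁, hP₁def⟩ : ∃ P₁ : Fin (q + 1) → Fin (q + 1) → Fin (q + 1) → K[X],
      P₁ = fun a b c => ∑ i, u i a * v i b * v i c := ⟨_, rfl⟩
  have hP₁ : ∀ a b c, ∀ j ≤ 3, (P₁ a b c).coeff j = if j = 3 then cwTensor K q a b c else 0 := by
    rw [hP₁def]; exact hdec
  obtain ⟨TL, hTLdef⟩ : ∃ TL : Fin (q + 1) → Fin (q + 1) → Fin (q + 1) → RatFunc K,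
      TL = fun a b c => φ (P₁ a b c) := ⟨_, rfl⟩
  have hTLdec : ∀ a b c, TL a b c = ∑ i, φ (u i a) * φ (v i b) * φ (v i c) := by
    intro a b c
    simp only [hTLdef, hP₁def, map_sum, map_mul]
  -- `uᵢ = sᵢ · vᵢ` with the scalars `s = (λ, …, λ, −1, 1 − qλ)`
  obtain ⟨sc, hsc⟩ : ∃ sc : Fin (q + 2) → K[X],
      sc = Fin.append (fun _ : Fin q => (X : K[X])) ![-1, 1 - (q : K[X]) * X] := ⟨_, rfl⟩
  have huv : ∀ i a, u i a = sc i * v i a := by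
    intro i a
    rw [hu, hv, hsc]
    induction i using Fin.addCases with
    | left i =>
        simp only [Fin.append_left]
        refine Fin.cases ?_ (fun a' => ?_) a
        · simp
        · simp only [Fin.cases_succ, mul_ite, mul_zero]
          split_ifs <;> ring
    | right j =>
        simp only [Fin.append_right]
        fin_cases j
        · refine Fin.cases ?_ (fun a' => ?_) a <;> simp
        · refine Fin.cases ?_ (fun a' => ?_) a <;> simp
  -- Lemma 7.1's vectors at `t = λ` are `φ ∘ v`
  set t : RatFunc K := φ X with ht
  obtain ⟨V, hV⟩ : ∃ V : Fin (q + 2) → Fin (q + 1) → RatFunc K, V =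
      Fin.append (fun i : Fin q => (Fin.cases 1 (fun r => if r = i then t else 0) : Fin (q + 1) → RatFunc K))
        ![Fin.cases 1 (fun _ => t ^ 2), Fin.cases 1 (fun _ => 0)] := ⟨_, rfl⟩
  have hvV : ∀ i r, φ (v i r) = V i r := by
    intro i r
    rw [hv, hV]
    induction i using Fin.addCases with
    | left i =>
        simp only [Fin.append_left]
        refine Fin.cases ?_ (fun r' => ?_) r
        · simp
        · simp only [Fin.cases_succ, apply_ite φ, map_zero, ht]
    | right j =>
        simp only [Fin.append_right]
        fin_cases j
        · refine Fin.cases ?_ (fun r' => ?_) r <;> simp [ht]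
        · refine Fin.cases ?_ (fun r' => ?_) r <;> simp
  -- nonvanishing: `β = (1 − qλ)² + qλ² ≠ 0`, `λ ≠ 0`, `1 − qλ ≠ 0` in `K(λ)`
  have hne_of_coeff : ∀ p : K[X], p.coeff 0 = 1 → φ p ≠ 0 := by
    intro p hp h
    have h0 : p = 0 := hφ (by rw [h, map_zero])
    rw [h0, Polynomial.coeff_zero] at hp
    exact zero_ne_one hp
  have hβ : (1 - (q : RatFunc K) * t) ^ 2 + (q : RatFunc K) * t ^ 2 ≠ 0 := by
    have h1 : φ ((1 - (q : K[X]) * X) ^ 2 + (q : K[X]) * X ^ 2) =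
        (1 - (q : RatFunc K) * t) ^ 2 + (q : RatFunc K) * t ^ 2 := by
      simp [ht, map_natCast]
    rw [← h1]
    refine hne_of_coeff _ ?_
    rw [Polynomial.coeff_zero_eq_eval_zero]
    simp
  have hsc0 : ∀ i, φ (sc i) ≠ 0 := by
    intro i
    rw [hsc]
    induction i using Fin.addCases with
    | left i =>
        rw [Fin.append_left]
        exact fun h => Polynomial.X_ne_zero (hφ (by rw [h, map_zero]))
    | right j =>
        rw [Fin.append_right]
        fin_cases j
        · simp
        · refine hne_of_coeff _ ?_
          rw [Polynomial.coeff_zero_eq_eval_zero]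
          simp
  -- the functional `c'ᵢ = (Lemma 7.1 coefficient)ᵢ / φ(sᵢ)`, nonzero
  obtain ⟨coef, hcoef⟩ : ∃ coef : Fin (q + 2) → RatFunc K, coef =
      Fin.append (fun _ : Fin q => (1 : RatFunc K))
        ![-((1 - (q : RatFunc K) * t) ^ 2 + (q : RatFunc K) * t ^ 2)⁻¹, 1] := ⟨_, rfl⟩
  obtain ⟨c', hc'⟩ : ∃ c' : Fin (q + 2) → RatFunc K, c' = fun i => coef i / φ (sc i) := ⟨_, rfl⟩
  have hc'0 : ∀ i, c' i ≠ 0 := fun i => by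
    rw [hc']
    exact div_ne_zero (by rw [hcoef]; exact lemma71_coeff_ne_zero q t hβ i) (hsc0 i)
  -- Lemma 7.1: `rank (∑ᵢ φ(uᵢ) φ(vᵢ)ᵀ c'ᵢ) ≤ q`
  have hM1 : (Matrix.of fun a b : Fin (q + 1) => ∑ i, φ (u i a) * φ (v i b) * c' i).rank ≤ q := by
    have heq : (Matrix.of fun a b : Fin (q + 1) => ∑ i, φ (u i a) * φ (v i b) * c' i) =
        Matrix.of fun r s : Fin (q + 1) => ∑ i : Fin (q + 2), coef i * V i r * V i s := by
      ext a b
      simp only [Matrix.of_apply]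
      refine Finset.sum_congr rfl fun i _ => ?_
      rw [huv, map_mul, hvV, hvV, hc']
      calc φ (sc i) * V i a * V i b * (coef i / φ (sc i))
          = coef i * V i a * V i b * (φ (sc i) / φ (sc i)) := by ring
        _ = coef i * V i a * V i b := by rw [div_self (hsc0 i), mul_one]
    rw [heq, hcoef, hV]
    exact lemma71_rank_le q t hβ
  -- tensoring: decomposition of `T_L^{⊠n}` and `rank (M^{⊗n}) ≤ q^n`
  exact ⟨P₁, fun i a => φ (u i a), fun i b => φ (v i b), fun i c => φ (v i c), c', hP₁,
    fun a b c => by rw [← hTLdec a b c, hTLdef], hc'0, hM1⟩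

/-- **Alman–Li 2026, Prop. 7.1.** For all `q, n`:
`cw_q^{⊠n} ⊕ ⟨1, (q+2)^n + q^n − 2(q+1)^n, 1⟩ ⊴ ⟨(q+2)^n⟩ ⊕ ⟨1, q^n, 1⟩` over any field `K`
(slices with trivial factor third; truncated subtraction). Printed proof, executed over `L = K(λ)`:
the CW data are a rank-`(q+2)` decomposition of `T_L = λ³cw_q + O(λ⁴)`; Lemma 7.1; tensoring;
Thm. 6.1 (rank decompositions) over `L`; bootstrapping to `K`. [cite: AlmanLi2026, Prop. 7.1] -/
theorem prop71 (n : ℕ) :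
    AlgDegeneratesTo
      (directSumTensor (unitTensor K ((q + 2) ^ n)) (rotate (oneSliceTensor K (Fin (q ^ n)))))
      (directSumTensor (kroneckerPow (cwTensor K q) n)
        (rotate (oneSliceTensor K (Fin ((q + 2) ^ n + q ^ n - 2 * (q + 1) ^ n))))) := by
  classical
  -- the field `L = K(λ) = RatFunc K`, the embedding `φ : K[λ] → L`, and the data of the first half
  set φ : K[X] →+* RatFunc K := algebraMap K[X] (RatFunc K) with hφdef
  obtain ⟨P₁, u, v, w, c', hP₁, hdec, hc'0, hM1⟩ := prop71_data K q
  obtain ⟨TL, hTLdef⟩ : ∃ TL : Fin (q + 1) → Fin (q + 1) → Fin (q + 1) → RatFunc K,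
      TL = fun a b c => φ (P₁ a b c) := ⟨_, rfl⟩
  have hTLdec : ∀ a b c, TL a b c = ∑ i, u i a * v i b * w i c := by
    intro a b c
    rw [hTLdef]
    exact hdec a b c
  have hTn : ∀ a b c, kroneckerPow TL n a b c = ∑ f : Fin n → Fin (q + 2),
      (∏ l, u (f l) (a l)) * (∏ l, v (f l) (b l)) * ∏ l, w (f l) (c l) :=
    kroneckerPow_eq_sum_decomposition (A := fun a i => u i a) (B := fun b i => v i b)
      (C := fun c i => w i c) hTLdec n
  have hMn : (Matrix.of fun (a b : Fin n → Fin (q + 1)) => ∑ f : Fin n → Fin (q + 2),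
      (∏ l, u (f l) (a l)) * (∏ l, v (f l) (b l)) * ∏ l, c' (f l)).rank ≤ q ^ n := by
    rw [contraction_pow_eq_powMatrix (fun a i => u i a) (fun b i => v i b) c' n]
    exact (rank_powMatrix_le _ n).trans (Nat.pow_le_pow_left hM1 n)
  -- Thm. 6.1 (rank-decomposition case) over `L`
  have e : (Fin n → Fin (q + 2)) ≃ Fin ((q + 2) ^ n) :=
    Fintype.equivFinOfCardEq (by rw [Fintype.card_fun, Fintype.card_fin, Fintype.card_fin])
  have hdegL := thm61_rankDecomposition_equiv (K := RatFunc K) e (T := kroneckerPow TL n)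
    (A := fun a f => ∏ l, u (f l) (a l)) (B := fun b f => ∏ l, v (f l) (b l))
    (C₀ := fun c f => ∏ l, w (f l) (c l)) hTn (c' := fun f => ∏ l, c' (f l))
    (fun f => prod_coeff_ne_zero hc'0 f) hMn
  -- the slice size produced, `t₀ = (q+2)^n + q^n − (N + N)` with `N = |Fin n → Fin (q+1)| = (q+1)^n`
  set t₀ := (q + 2) ^ n + q ^ n -
    (Fintype.card (Fin n → Fin (q + 1)) + Fintype.card (Fin n → Fin (q + 1))) with ht₀
  have hcard : Fintype.card (Fin n → Fin (q + 1)) = (q + 1) ^ n := by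
    rw [Fintype.card_fun, Fintype.card_fin, Fintype.card_fin]
  -- equalise the `λ`-order: scale the slice block by `λ^{3n}` (an `L`-restriction) and read the
  -- target as the image of the `K[λ]`-tensor `P = P₁^{⊠n} ⊕ λ^{3n}·⟨1,t₀,1⟩`
  obtain ⟨P, hPdef⟩ : ∃ P : (Fin n → Fin (q + 1)) ⊕ Fin t₀ → (Fin n → Fin (q + 1)) ⊕ Fin t₀ →
      (Fin n → Fin (q + 1)) ⊕ Unit → K[X],
      P = directSumTensor (kroneckerPow P₁ n)
        (fun x y z => X ^ (n * 3) * Polynomial.C (rotate (oneSliceTensor K (Fin t₀)) x y z)) := ⟨_, rfl⟩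
  have hscale : TensorRestrictsTo
      (directSumTensor (kroneckerPow TL n) (rotate (oneSliceTensor (RatFunc K) (Fin t₀))))
      (fun a b c => φ (P a b c)) := by
    refine ⟨fun a a' => if a' = a then 1 else 0, fun b b' => if b' = b then 1 else 0,
      fun c c' => if c' = c then Sum.elim (fun _ => (1 : RatFunc K)) (fun _ => φ X ^ (n * 3)) c else 0,
      fun a b c => ?_⟩
    rw [Finset.sum_eq_single a (fun x _ hx => by simp [hx]) (by simp),
      Finset.sum_eq_single b (fun x _ hx => by simp [hx]) (by simp),
      Finset.sum_eq_single c (fun x _ hx => by simp [hx]) (by simp)]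
    simp only [if_true, one_mul]
    rcases a with a | a <;> rcases b with b | b <;> rcases c with c | c <;>
      simp [hPdef, directSumTensor, hTLdef, kroneckerPow_apply, map_prod, rotate_apply,
        oneSliceTensor_apply, apply_ite Polynomial.C, apply_ite φ]
  have hdegL' : AlgDegeneratesTo
      (fun a b c => φ (Polynomial.C
        (directSumTensor (unitTensor K ((q + 2) ^ n)) (rotate (oneSliceTensor K (Fin (q ^ n)))) a b c)))
      (fun a b c => φ (P a b c)) := by
    rw [← directSum_unit_slice_eq_map K]
    exact hdegL.trans_restrictsTo hscale
  -- the `λ`-adic lowest term of `P` is `cw_q^{⊠n} ⊕ ⟨1,t₀,1⟩` at order `3n`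
  have hPcoeff : ∀ a b c, ∀ j ≤ n * 3, (P a b c).coeff j = if j = n * 3 then
      directSumTensor (kroneckerPow (cwTensor K q) n) (rotate (oneSliceTensor K (Fin t₀))) a b c
      else 0 := by
    intro a b c j hj
    rcases a with a | a <;> rcases b with b | b <;> rcases c with c | c
    · rw [hPdef, directSumTensor_inl, directSumTensor_inl]
      exact kroneckerPow_coeff_of_lowest hP₁ n a b c j hj
    · simp [hPdef, directSumTensor]
    · simp [hPdef, directSumTensor]
    · simp [hPdef, directSumTensor]
    · simp [hPdef, directSumTensor]
    · simp [hPdef, directSumTensor]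
    · simp [hPdef, directSumTensor]
    · rw [hPdef, directSumTensor_inr, directSumTensor_inr, Polynomial.coeff_X_pow_mul',
        Polynomial.coeff_C]
      by_cases hjn : j = n * 3
      · subst hjn
        simp
      · rw [if_neg hjn]
        split_ifs with h1 h2
        · omega
        · rfl
        · rfl
  -- bootstrap `K(λ) → K`
  have hK := algDegeneratesTo_of_isFractionRing (K := K) (L := RatFunc K) hPcoeff hdegL'
  -- shrink the slice `⟨1,t₀,1⟩ ≥ ⟨1, (q+2)^n + q^n − 2(q+1)^n, 1⟩` (`t₀` equals it)
  refine hK.trans_restrictsTo ((TensorRestrictsTo.refl _).directSum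
    (tensorRestrictsTo_rotate_oneSliceTensor_of_le ?_))
  rw [ht₀, hcard]
  omega

end AlmanLi2026

end Literature.Computability.AlgebraicComplexity
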